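import Summits.CriticalPhenomena.PercolationContinuityZ3.Theorems.Transplant.FKThreeApexPinnedNC
import Summits.CriticalPhenomena.PercolationContinuityZ3.Theorems.Transplant.FKThreeApexT3Form
import Summits.CriticalPhenomena.PercolationContinuityZ3.Theorems.Transplant.FKConnectivityAllQK5Disj

/-!
# Connectivity correlation inequalities for `φ_{w,q}`, `0 < q ≤ 1` — the three-apex monoid of `K_{1,1,1,n}`:
# the T3 form is non-negative on the TORIC FACE (products of the three triangle letters), from the `K₅` theorem

Helper file (`--supports stmt-CriticalPhenomena-4575`), FK sub-lane `prim-bschramm-fk-3` (gen 15); builds on p205010 (kernel theorem,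
internal audit signed; external expert review pending).  No named facts, no sorries; standard axioms.

The last open pair type T3 of `K_{1,1,1,n}` (leaf edges `u₁a`, `u₂b` at different apices) has Rayleigh difference `t3Form q b₁ c₁ a₂ c₂ R`
(`FKThreeApexT3Form`, `rayleigh_T3_eq`), `R` = hat data of the other letters.  In the ratio coordinates `(A,B,C,V) = (x̂,ŷ,ẑ,v̂)/û` the
form is LINEAR in `V`, so its positivity on the outer set `{Λ ≥ 0, caps, Φ^{nat} ≥ 0}` of the monoid reduces to its faces (memo
`bschramm/prim-bschramm-fk-3/T3-STRUCTURE.md` §7).  The TORIC face `V = ABC` consists exactly of the products of the three triangle letters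
`edgeAB w₁ · edgeAC w₂ · edgeBC w₃` — i.e. of `R` = a weighted triangle and NO further leaves: the graph `K_{1,1,1,2} ⊆ K₅`.  Hence T3 on the
toric face is an instance of the kernel theorem **`FK.edgeNegCorrOn_of_card_le_five`** (`K₅` is Potts–Rayleigh, gen 11).  This file performs
the plumbing:
* `FK.pinned_rayleigh_of_negCorr` — the converse of `FK.negCorr_of_pinned_rayleigh`: for `0 < w e, w f < 1`, negative correlation of
  `J_e, J_f` under `φ_{w,q}` gives `Z_{w[e↦1][f↦1]} Z_{w[e↦0][f↦0]} ≤ Z_{w[e↦1][f↦0]} Z_{w[e↦0][f↦1]}` (bi-affinity + the identity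
  `S_e S_f − S_{ef} Z = s t (1−s)(1−t)(Z¹⁰Z⁰¹ − Z¹¹Z⁰⁰)`);
* `ThreeApex.zvec_pin_ab`, `ThreeApex.t3Form_nonneg_of_negCorr` — in the weighted `K_{1,1,1,n}`, negative correlation of `s(a, v j₁)` and
  `s(b, v j₂)` (`j₁ ≠ j₂`) is EQUIVALENT data to `t3Form ≥ 0` at `R` = triangle letters · other leaves (transfer formula
  `rcPartitionFunctionW_eq_transfer3T` + `rayleigh_T3_eq`);
* **`ThreeApex.t3Form_triangle_nonneg`** — `0 ≤ t3Form q b₁ c₁ a₂ c₂ (edgeAB w₁ · (edgeAC w₂ · edgeBC w₃))` for all `q ∈ (0,1]` and all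
  parameters in `[0,1]` (the concrete `K_{1,1,1,2}` on `Fin 5` + the `K₅` theorem).
[cite: Grimmett2006, §3.9 eq. (3.94) (pp. 63–64); §1.4 eq. (1.20) (p. 15)] [cite: Wagner2006, Ex. 5.2, Conj. 5.3] [folklore]
-/

noncomputable section

namespace Summit.CriticalPhenomena.PercolationContinuityZ3.Theorems

namespace FK

open Literature.Probability.LatticeModels Literature.Probability.Percolation
open Literature.Probability.Percolation.DecisionTree (ind ind_of_mem ind_of_not_mem ind_nonneg)
open scoped Classical

variable {V : Type*} [Fintype V]

/-! ### Negative correlation ⇒ pinned Rayleigh (converse of `negCorr_of_pinned_rayleigh`) -/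

/-- **Negative correlation ⇒ pinned Rayleigh.**  For any finite weighted graph, `0 < q`, pairs `f ≠ e` with `0 < w e < 1`, `0 < w f < 1`:
`φ_{w,q}(J_e ∩ J_f) ≤ φ_{w,q}(J_e)·φ_{w,q}(J_f)` implies `Z_{w[e↦1][f↦1]}·Z_{w[e↦0][f↦0]} ≤ Z_{w[e↦1][f↦0]}·Z_{w[e↦0][f↦1]}`.
[cite: Grimmett2006, §1.4 eq. (1.20) (p. 15); §3.9 eq. (3.94)] -/
theorem pinned_rayleigh_of_negCorr (w : Sym2 V → unitInterval) {q : ℝ} (hq0 : 0 < q) {e f : Sym2 V} (hfe : f ≠ e)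
    (hs0 : 0 < ((w e : unitInterval) : ℝ)) (hs1 : ((w e : unitInterval) : ℝ) < 1)
    (ht0 : 0 < ((w f : unitInterval) : ℝ)) (ht1 : ((w f : unitInterval) : ℝ) < 1)
    (h : (rcMeasureW w q ∅).real ({ω : BondConfig V | e ∈ ω} ∩ {ω | f ∈ ω}) ≤
      (rcMeasureW w q ∅).real {ω : BondConfig V | e ∈ ω} * (rcMeasureW w q ∅).real {ω : BondConfig V | f ∈ ω}) :
    rcPartitionFunctionW (Function.update (Function.update w e 1) f 1) q ∅ *
        rcPartitionFunctionW (Function.update (Function.update w e 0) f 0) q ∅ ≤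
      rcPartitionFunctionW (Function.update (Function.update w e 1) f 0) q ∅ *
        rcPartitionFunctionW (Function.update (Function.update w e 0) f 1) q ∅ := by
  have hZw : rcPartitionFunctionW w q ∅ = rcPartitionFunctionW (Function.update (Function.update w e (w e)) f (w f)) q ∅ := by
    rw [Function.update_eq_self, Function.update_eq_self]
  have hSe : ∑ ω : BondConfig V, rcWeightW w q ∅ ω * ind {ω : BondConfig V | e ∈ ω} ω =
      ((w e : unitInterval) : ℝ) * rcPartitionFunctionW (Function.update (Function.update w e 1) f (w f)) q ∅ := by
    rw [Wheel.sum_openPair_eq_mul_Z w q e]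
    congr 2
    conv_lhs => rw [← Function.update_eq_self f (Function.update w e 1)]
    rw [Function.update_of_ne hfe]
  have hSf : ∑ ω : BondConfig V, rcWeightW w q ∅ ω * ind {ω : BondConfig V | f ∈ ω} ω =
      ((w f : unitInterval) : ℝ) * rcPartitionFunctionW (Function.update (Function.update w e (w e)) f 1) q ∅ := by
    rw [Wheel.sum_openPair_eq_mul_Z w q f, Function.update_eq_self]
  have hSef : ∑ ω : BondConfig V, rcWeightW w q ∅ ω * ind ({ω : BondConfig V | e ∈ ω} ∩ {ω | f ∈ ω}) ω =
      ((w e : unitInterval) : ℝ) * ((w f : unitInterval) : ℝ) * rcPartitionFunctionW (Function.update (Function.update w e 1) f 1) q ∅ :=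
    Wheel.sum_openPair_inter_openPair_eq w q hfe
  have hB := fun (σ τ : unitInterval) => rcPartitionFunctionW_biaffine w q hfe σ τ
  have key : ∀ (s t Z00 Z10 Z01 Z11 : ℝ),
      (s * ((1 - 1) * (1 - t) * Z00 + 1 * (1 - t) * Z10 + (1 - 1) * t * Z01 + 1 * t * Z11)) *
          (t * ((1 - s) * (1 - 1) * Z00 + s * (1 - 1) * Z10 + (1 - s) * 1 * Z01 + s * 1 * Z11)) -
        (s * t * Z11) * ((1 - s) * (1 - t) * Z00 + s * (1 - t) * Z10 + (1 - s) * t * Z01 + s * t * Z11) =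
      s * t * ((1 - s) * (1 - t)) * (Z10 * Z01 - Z11 * Z00) := by
    intro s t Z00 Z10 Z01 Z11; ring
  have hZpos := rcPartitionFunctionW_pos w hq0 (∅ : Set V)
  -- the hypothesis in terms of the sums: `S_{ef} · Z ≤ S_e · S_f`
  have main : (∑ ω : BondConfig V, rcWeightW w q ∅ ω * ind ({ω : BondConfig V | e ∈ ω} ∩ {ω | f ∈ ω}) ω) * rcPartitionFunctionW w q ∅ ≤
      (∑ ω : BondConfig V, rcWeightW w q ∅ ω * ind {ω : BondConfig V | e ∈ ω} ω) *
        ∑ ω : BondConfig V, rcWeightW w q ∅ ω * ind {ω : BondConfig V | f ∈ ω} ω := by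
    rw [rcMeasureW_real_eq_sum_div w hq0, rcMeasureW_real_eq_sum_div w hq0, rcMeasureW_real_eq_sum_div w hq0, div_mul_div_comm,
      div_le_div_iff₀ hZpos (mul_pos hZpos hZpos)] at h
    nlinarith [h, hZpos]
  rw [hSef, hSe, hSf, hZw, hB 1 (w f), hB (w e) 1, hB (w e) (w f), Set.Icc.coe_one] at main
  have k := key ((w e : unitInterval) : ℝ) ((w f : unitInterval) : ℝ)
    (rcPartitionFunctionW (Function.update (Function.update w e 0) f 0) q ∅)
    (rcPartitionFunctionW (Function.update (Function.update w e 1) f 0) q ∅)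
    (rcPartitionFunctionW (Function.update (Function.update w e 0) f 1) q ∅)
    (rcPartitionFunctionW (Function.update (Function.update w e 1) f 1) q ∅)
  have hpos : 0 < ((w e : unitInterval) : ℝ) * ((w f : unitInterval) : ℝ) *
      ((1 - ((w e : unitInterval) : ℝ)) * (1 - ((w f : unitInterval) : ℝ))) :=
    mul_pos (mul_pos hs0 ht0) (mul_pos (sub_pos.2 hs1) (sub_pos.2 ht1))
  have hprod : 0 ≤ ((w e : unitInterval) : ℝ) * ((w f : unitInterval) : ℝ) *
      ((1 - ((w e : unitInterval) : ℝ)) * (1 - ((w f : unitInterval) : ℝ))) *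
      (rcPartitionFunctionW (Function.update (Function.update w e 1) f 0) q ∅ *
          rcPartitionFunctionW (Function.update (Function.update w e 0) f 1) q ∅ -
        rcPartitionFunctionW (Function.update (Function.update w e 1) f 1) q ∅ *
          rcPartitionFunctionW (Function.update (Function.update w e 0) f 0) q ∅) := by
    nlinarith [main, k]
  have hX := (mul_nonneg_iff_of_pos_left hpos).1 hprod
  linarith

namespace ThreeApex

section Setting

variable {a b c : V} {v : ℕ → V} {n : ℕ}
variable (hab : a ≠ b) (hac : a ≠ c) (hbc : b ≠ c) (hinj : ∀ j k, j < n → k < n → v j = v k → j = k)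
  (hva : ∀ j, j < n → v j ≠ a) (hvb : ∀ j, j < n → v j ≠ b) (hvc : ∀ j, j < n → v j ≠ c)
include hab hac hbc hinj hva hvb hvc

omit [Fintype V] in
/-- Pinning the `a`-edge of leaf `j₁` to `σ` and the `b`-edge of leaf `j₂ ≠ j₁` to `τ` replaces their letters by `leaf σ b₁ c₁` and
`leaf a₂ τ c₂`. [folklore] -/
theorem zvec_pin_ab (q : ℝ) (w : Sym2 V → unitInterval) {j₁ j₂ : ℕ} (hj₁ : j₁ < n) (hj₂ : j₂ < n) (hne : j₁ ≠ j₂)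
    (σ τ : unitInterval) :
    zvec q (Function.update (Function.update w s(a, v j₁) σ) s(b, v j₂) τ) a b c v n =
      leaf q (σ : ℝ) ((w s(b, v j₁) : unitInterval) : ℝ) ((w s(c, v j₁) : unitInterval) : ℝ) *
        (leaf q ((w s(a, v j₂) : unitInterval) : ℝ) (τ : ℝ) ((w s(c, v j₂) : unitInterval) : ℝ) *
          ∏ j ∈ ((Finset.range n).erase j₁).erase j₂, leafOf q w a b c (v j)) := by
  obtain ⟨nab₁, nac₁, -⟩ := pairs_at_leaf_ne hab hac hbc hva hvb hj₁
  obtain ⟨nab₂, -, nbc₂⟩ := pairs_at_leaf_ne hab hac hbc hva hvb hj₂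
  have hmem₁ : j₁ ∈ Finset.range n := Finset.mem_range.2 hj₁
  have hmem₂ : j₂ ∈ (Finset.range n).erase j₁ := Finset.mem_erase.2 ⟨fun h => hne h.symm, Finset.mem_range.2 hj₂⟩
  have hab₁₂ : s(a, v j₁) ≠ s(b, v j₂) := pair_ne_of_ne hinj hva hvb hvc (x := a) (y := b) (Or.inl rfl) hj₁ hj₂ hne
  have hbb : s(b, v j₁) ≠ s(b, v j₂) := pair_ne_of_ne hinj hva hvb hvc (x := b) (y := b) (Or.inr (Or.inl rfl)) hj₁ hj₂ hne
  have hcb : s(c, v j₁) ≠ s(b, v j₂) := pair_ne_of_ne hinj hva hvb hvc (x := c) (y := b) (Or.inr (Or.inr rfl)) hj₁ hj₂ hne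
  have haa' : s(a, v j₂) ≠ s(a, v j₁) := pair_ne_of_ne hinj hva hvb hvc (x := a) (y := a) (Or.inl rfl) hj₂ hj₁ (Ne.symm hne)
  have hca' : s(c, v j₂) ≠ s(a, v j₁) := pair_ne_of_ne hinj hva hvb hvc (x := c) (y := a) (Or.inr (Or.inr rfl)) hj₂ hj₁ (Ne.symm hne)
  rw [zvec_eq_prod, ← Finset.mul_prod_erase _ _ hmem₁, ← Finset.mul_prod_erase _ _ hmem₂]
  congr 1
  · simp only [leafOf, Function.update_of_ne hab₁₂, Function.update_self, Function.update_of_ne hbb,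
      Function.update_of_ne nab₁.symm, Function.update_of_ne hcb, Function.update_of_ne nac₁.symm]
  · congr 1
    · simp only [leafOf, Function.update_self, Function.update_of_ne nab₂, Function.update_of_ne haa',
        Function.update_of_ne nbc₂.symm, Function.update_of_ne hca']
    · refine Finset.prod_congr rfl fun j hj => ?_
      have hj' : j ≠ j₂ ∧ j ≠ j₁ ∧ j < n := by simpa [Finset.mem_erase, Finset.mem_range] using hj
      rw [leafOf_update_of_ne hinj hva hvb hvc q _ b hj₂ hj'.2.2 hj'.1 τ, leafOf_update_of_ne hinj hva hvb hvc q w a hj₁ hj'.2.2 hj'.2.1 σ]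

/-- **Negative correlation of `u₁a, u₂b` ⇔-data: `t3Form ≥ 0`.**  In the weighted `K_{1,1,1,n}`, if the leaf edges `s(a, v j₁)`,
`s(b, v j₂)` (`j₁ ≠ j₂`) carry weights in `(0,1)` and are negatively correlated under `φ_{w,q}` (`0 < q`), then the T3 form of the remaining
letters (triangle letters · other leaves) at the parameters `b₁ = w s(b,v j₁), c₁ = w s(c,v j₁), a₂ = w s(a,v j₂), c₂ = w s(c,v j₂)` is `≥ 0`.
[cite: Grimmett2006, §1.4 eq. (1.20) (p. 15)] -/
theorem t3Form_nonneg_of_negCorr {q : ℝ} (hq0 : 0 < q) (hcard : Fintype.card V = n + 3) (w : Sym2 V → unitInterval)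
    (hsupp : ∀ e, e ∉ fullPairs a b c v n → w e = 0) {j₁ j₂ : ℕ} (hj₁ : j₁ < n) (hj₂ : j₂ < n) (hne : j₁ ≠ j₂)
    (hs0 : 0 < ((w s(a, v j₁) : unitInterval) : ℝ)) (hs1 : ((w s(a, v j₁) : unitInterval) : ℝ) < 1)
    (ht0 : 0 < ((w s(b, v j₂) : unitInterval) : ℝ)) (ht1 : ((w s(b, v j₂) : unitInterval) : ℝ) < 1)
    (hNC : (rcMeasureW w q ∅).real ({ω : BondConfig V | s(a, v j₁) ∈ ω} ∩ {ω | s(b, v j₂) ∈ ω}) ≤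
      (rcMeasureW w q ∅).real {ω : BondConfig V | s(a, v j₁) ∈ ω} * (rcMeasureW w q ∅).real {ω : BondConfig V | s(b, v j₂) ∈ ω}) :
    0 ≤ t3Form q ((w s(b, v j₁) : unitInterval) : ℝ) ((w s(c, v j₁) : unitInterval) : ℝ)
        ((w s(a, v j₂) : unitInterval) : ℝ) ((w s(c, v j₂) : unitInterval) : ℝ)
        (triLetter w a b c * ∏ j ∈ ((Finset.range n).erase j₁).erase j₂, leafOf q w a b c (v j)) := by
  have hfe : s(b, v j₂) ≠ s(a, v j₁) :=
    (pair_ne_of_ne hinj hva hvb hvc (x := a) (y := b) (Or.inl rfl) hj₁ hj₂ hne).symm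
  have he : s(a, v j₁) ∈ fullPairs a b c v n := mem_fullPairs_of (Or.inl ((mem_apexPairs_iff _).2 ⟨j₁, hj₁, Or.inl rfl⟩))
  have hf : s(b, v j₂) ∈ fullPairs a b c v n := mem_fullPairs_of (Or.inl ((mem_apexPairs_iff _).2 ⟨j₂, hj₂, Or.inr (Or.inl rfl)⟩))
  set R := triLetter w a b c * ∏ j ∈ ((Finset.range n).erase j₁).erase j₂, leafOf q w a b c (v j) with hR
  have hZ : ∀ σ τ : unitInterval, rcPartitionFunctionW (Function.update (Function.update w s(a, v j₁) σ) s(b, v j₂) τ) q ∅ =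
      val q (leaf q (σ : ℝ) ((w s(b, v j₁) : unitInterval) : ℝ) ((w s(c, v j₁) : unitInterval) : ℝ) *
        (leaf q ((w s(a, v j₂) : unitInterval) : ℝ) (τ : ℝ) ((w s(c, v j₂) : unitInterval) : ℝ) * R)) := by
    intro σ τ
    rw [rcPartitionFunctionW_eq_transfer3T hab hac hbc hinj hva hvb hvc hcard q _
      (supp_update_fullPair _ (supp_update_fullPair w hsupp he σ) hf τ), transfer3T,
      triLetter_pin_leaves hva hvb hvc (v := v) w a b hj₁ hj₂ σ τ, zvec_pin_ab hab hac hbc hinj hva hvb hvc q w hj₁ hj₂ hne σ τ, hR]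
    simp only [← mul_assoc]
    congr 1
    ac_rfl
  have hpin := pinned_rayleigh_of_negCorr w hq0 hfe hs0 hs1 ht0 ht1 hNC
  rw [hZ, hZ, hZ, hZ, Set.Icc.coe_one, Set.Icc.coe_zero] at hpin
  have hid := rayleigh_T3_eq q ((w s(b, v j₁) : unitInterval) : ℝ) ((w s(c, v j₁) : unitInterval) : ℝ)
    ((w s(a, v j₂) : unitInterval) : ℝ) ((w s(c, v j₂) : unitInterval) : ℝ) R
  simp only [← mul_def] at hid
  linarith

end Setting

/-! ### The concrete `K_{1,1,1,2}` on `Fin 5` and the toric face -/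

/-- The two leaves of `K_{1,1,1,2}` on `Fin 5`: `v 0 = 3`, `v j = 4` otherwise. [folklore] -/
def v₂ : ℕ → Fin 5 := fun j => if j = 0 then 3 else 4

/-- Symmetric weight table of `K_{1,1,1,2}` on `Fin 5` (apices `0,1,2`, leaves `3,4`): triangle `w₁,w₂,w₃`, marked leaf edges
`s(0,3), s(1,4)` of weight `1/2`, free leaf edges `b₁,c₁` (leaf `3`) and `a₂,c₂` (leaf `4`), everything else `0`. [folklore] -/
def toricTable (w₁ w₂ w₃ b₁ c₁ a₂ c₂ : ℝ) (i j : ℕ) : ℝ :=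
  if min i j = 0 ∧ max i j = 1 then w₁ else if min i j = 0 ∧ max i j = 2 then w₂ else if min i j = 1 ∧ max i j = 2 then w₃
  else if min i j = 0 ∧ max i j = 3 then 1 / 2 else if min i j = 1 ∧ max i j = 3 then b₁ else if min i j = 2 ∧ max i j = 3 then c₁
  else if min i j = 0 ∧ max i j = 4 then a₂ else if min i j = 1 ∧ max i j = 4 then 1 / 2 else if min i j = 2 ∧ max i j = 4 then c₂
  else 0

/-- The table is symmetric. [folklore] -/
theorem toricTable_symm (w₁ w₂ w₃ b₁ c₁ a₂ c₂ : ℝ) (i j : ℕ) :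
    toricTable w₁ w₂ w₃ b₁ c₁ a₂ c₂ i j = toricTable w₁ w₂ w₃ b₁ c₁ a₂ c₂ j i := by
  simp only [toricTable, min_comm i j, max_comm i j]

/-- The weight vector of `K_{1,1,1,2}` on `Fin 5` (values projected into `[0,1]`). [folklore] -/
def toricW (w₁ w₂ w₃ b₁ c₁ a₂ c₂ : ℝ) : Sym2 (Fin 5) → unitInterval :=
  Sym2.lift ⟨fun i j => Set.projIcc (0 : ℝ) 1 zero_le_one (toricTable w₁ w₂ w₃ b₁ c₁ a₂ c₂ i.val j.val),
    fun i j => congrArg _ (toricTable_symm w₁ w₂ w₃ b₁ c₁ a₂ c₂ i.val j.val)⟩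

/-- Value of the weight vector on a pair. [folklore] -/
theorem toricW_mk (w₁ w₂ w₃ b₁ c₁ a₂ c₂ : ℝ) (i j : Fin 5) :
    toricW w₁ w₂ w₃ b₁ c₁ a₂ c₂ s(i, j) = Set.projIcc (0 : ℝ) 1 zero_le_one (toricTable w₁ w₂ w₃ b₁ c₁ a₂ c₂ i.val j.val) := by
  simp [toricW]

/-- Real value of the weight on a pair whose table entry lies in `[0,1]`. [folklore] -/
theorem toricW_val {w₁ w₂ w₃ b₁ c₁ a₂ c₂ : ℝ} (i j : Fin 5) {t : ℝ} (ht : toricTable w₁ w₂ w₃ b₁ c₁ a₂ c₂ i.val j.val = t)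
    (h0 : 0 ≤ t) (h1 : t ≤ 1) : ((toricW w₁ w₂ w₃ b₁ c₁ a₂ c₂ s(i, j) : unitInterval) : ℝ) = t := by
  rw [toricW_mk, ht, Set.projIcc_of_mem zero_le_one ⟨h0, h1⟩]

/-- **T3 on the toric face.**  For `0 < q ≤ 1` and all parameters in `[0,1]`, the T3 form of the product of the three triangle letters
is non-negative: `0 ≤ t3Form q b₁ c₁ a₂ c₂ (edgeAB w₁ · (edgeAC w₂ · edgeBC w₃))` — the graph `K_{1,1,1,2} ⊆ K₅`, so this is the
`K₅` theorem `edgeNegCorrOn_of_card_le_five` read through the transfer formula. [cite: Wagner2006, Ex. 5.2, Conj. 5.3] -/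
theorem t3Form_triangle_nonneg {q : ℝ} (hq0 : 0 < q) (hq1 : q ≤ 1) {w₁ w₂ w₃ b₁ c₁ a₂ c₂ : ℝ}
    (hw₁0 : 0 ≤ w₁) (hw₁1 : w₁ ≤ 1) (hw₂0 : 0 ≤ w₂) (hw₂1 : w₂ ≤ 1) (hw₃0 : 0 ≤ w₃) (hw₃1 : w₃ ≤ 1)
    (hb0 : 0 ≤ b₁) (hb1 : b₁ ≤ 1) (hc0 : 0 ≤ c₁) (hc1 : c₁ ≤ 1) (ha0 : 0 ≤ a₂) (ha1 : a₂ ≤ 1) (hd0 : 0 ≤ c₂) (hd1 : c₂ ≤ 1) :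
    0 ≤ t3Form q b₁ c₁ a₂ c₂ (edgeAB w₁ * (edgeAC w₂ * edgeBC w₃)) := by
  set w := toricW w₁ w₂ w₃ b₁ c₁ a₂ c₂ with hw
  have hab : (0 : Fin 5) ≠ 1 := by decide
  have hac : (0 : Fin 5) ≠ 2 := by decide
  have hbc : (1 : Fin 5) ≠ 2 := by decide
  have hv0 : v₂ 0 = 3 := rfl
  have hv1 : v₂ 1 = 4 := rfl
  have hvj : ∀ j, j < 2 → v₂ j = 3 ∨ v₂ j = 4 := by
    intro j hj; interval_cases j <;> simp [v₂]
  have hinj : ∀ j k, j < 2 → k < 2 → v₂ j = v₂ k → j = k := by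
    intro j k hj hk h; interval_cases j <;> interval_cases k <;> simp_all [v₂]
  have hva : ∀ j, j < 2 → v₂ j ≠ 0 := by intro j hj; rcases hvj j hj with h | h <;> rw [h] <;> decide
  have hvb : ∀ j, j < 2 → v₂ j ≠ 1 := by intro j hj; rcases hvj j hj with h | h <;> rw [h] <;> decide
  have hvc : ∀ j, j < 2 → v₂ j ≠ 2 := by intro j hj; rcases hvj j hj with h | h <;> rw [h] <;> decide
  have hcard : Fintype.card (Fin 5) = 2 + 3 := by simp
  -- support: the only pairs outside `fullPairs` are the diagonal pairs and `s(3,4)`, where the table is `0`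
  have hsupp : ∀ e, e ∉ fullPairs (0 : Fin 5) 1 2 v₂ 2 → w e = 0 := by
    intro e he
    induction e using Sym2.ind with
    | h i j =>
      have hex : ∀ P : ℕ → Prop, (∃ j, j < 2 ∧ P j) ↔ P 0 ∨ P 1 := by
        intro P
        constructor
        · rintro ⟨j, hj, hP⟩
          interval_cases j
          · exact Or.inl hP
          · exact Or.inr hP
        · rintro (hP | hP)
          · exact ⟨0, by norm_num, hP⟩
          · exact ⟨1, by norm_num, hP⟩
      have hmem : ∀ x y : Fin 5, s(x, y) ∈ fullPairs (0 : Fin 5) 1 2 v₂ 2 ∨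
          toricTable w₁ w₂ w₃ b₁ c₁ a₂ c₂ x.val y.val = 0 := by
        intro x y
        fin_cases x <;> fin_cases y <;> first
          | exact Or.inl (by simp only [mem_fullPairs_iff, mem_apexPairs_iff, mem_triPairs_iff, hex, hv0, hv1]; decide)
          | exact Or.inr (by simp [toricTable])
      rcases hmem i j with h | h
      · exact absurd h he
      · apply Subtype.ext
        rw [hw, toricW_mk, h, Set.projIcc_of_mem zero_le_one ⟨le_rfl, zero_le_one⟩]
        rfl
  -- values of the weight vector
  have e01 : ((w s(0, 1) : unitInterval) : ℝ) = w₁ := toricW_val 0 1 (by simp [toricTable]) hw₁0 hw₁1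
  have e02 : ((w s(0, 2) : unitInterval) : ℝ) = w₂ := toricW_val 0 2 (by simp [toricTable]) hw₂0 hw₂1
  have e12 : ((w s(1, 2) : unitInterval) : ℝ) = w₃ := toricW_val 1 2 (by simp [toricTable]) hw₃0 hw₃1
  have e03 : ((w s(0, 3) : unitInterval) : ℝ) = 1 / 2 := toricW_val 0 3 (by simp [toricTable]) (by norm_num) (by norm_num)
  have e13 : ((w s(1, 3) : unitInterval) : ℝ) = b₁ := toricW_val 1 3 (by simp [toricTable]) hb0 hb1
  have e23 : ((w s(2, 3) : unitInterval) : ℝ) = c₁ := toricW_val 2 3 (by simp [toricTable]) hc0 hc1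
  have e04 : ((w s(0, 4) : unitInterval) : ℝ) = a₂ := toricW_val 0 4 (by simp [toricTable]) ha0 ha1
  have e14 : ((w s(1, 4) : unitInterval) : ℝ) = 1 / 2 := toricW_val 1 4 (by simp [toricTable]) (by norm_num) (by norm_num)
  have e24 : ((w s(2, 4) : unitInterval) : ℝ) = c₂ := toricW_val 2 4 (by simp [toricTable]) hd0 hd1
  -- negative correlation from the `K₅` theorem
  have hNC := edgeNegCorrOn_of_card_le_five (V := Fin 5) (by simp) hq0 hq1 w s((0 : Fin 5), v₂ 0) s((1 : Fin 5), v₂ 1)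
    (by rw [hv0, Sym2.mk_isDiag_iff]; decide) (by rw [hv0, hv1]; decide)
  have h := t3Form_nonneg_of_negCorr hab hac hbc hinj hva hvb hvc hq0 hcard w hsupp (j₁ := 0) (j₂ := 1) (by norm_num) (by norm_num)
    (by norm_num) (by rw [hv0, e03]; norm_num) (by rw [hv0, e03]; norm_num) (by rw [hv1, e14]; norm_num) (by rw [hv1, e14]; norm_num) hNC
  have hprod : ((Finset.range 2).erase 0).erase 1 = ∅ := by decide
  rw [hprod, Finset.prod_empty, mul_one, hv0, hv1, e13, e23, e04, e24] at h
  have htri : triLetter w (0 : Fin 5) 1 2 = edgeAB w₁ * (edgeAC w₂ * edgeBC w₃) := by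
    simp only [triLetter, e01, e02, e12]
  rw [htri] at h
  exact h

end ThreeApex

end FK

end Summit.CriticalPhenomena.PercolationContinuityZ3.Theorems
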